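import Summits.BirchSwinnertonDyer.Rank1Residual.X1.GeneratorCountLayerAtPLocal
import Summits.BirchSwinnertonDyer.Rank1Residual.X1.GeneratorCountLayerCertificates
import Summits.BirchSwinnertonDyer.Rank1Residual.X1.GeneratorCountTorsionRat
import HarnessLib

/-!
# Route M at LAYER `n`, members WITH a rational point of order `p` (`δ = 1`): the census-column
# END `Σ_{v ∈ S} p^{min(n, m_v)} + 2 ≤ λ + pⁿ μ + 2k` and its leaf consumers
# (cell `b2b-bsdres`, unit `b2b-bsdres-eisenstein-p1`, gen 21; X1R0-GAPMAP §14.1, §26–§30)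

HONEST FRAMING (run/shared/lean/b2b/bsd-rank1-residual/, verbatim in every file): the goal of the
cell is to DELETE the COMBINATION-SHAPED residual classes of the Birch–Swinnerton-Dyer formula for
ALL analytic-rank `≤ 1` elliptic curves over `ℚ` — "full BSD formula for every rank `≤ 1` curve in
class `C`" assembled STRICTLY from published theorems — so that the rank-`≤ 1` remainder becomes
exactly the CONSTRUCTION-SHAPED classes, which are TYPED (missing-input `Prop`s), NOT attempted.
This is not "finishing BSD". Sub-cell `b2b-bsdres-eisenstein-p1` (CLASS-OWNERS row "X1 (r = 0)"):
research route; NO CLAIM BEYOND STATED CLASSES; nothing here changes a label; nothing is booked.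
THEOREMS ONLY — no definition, no named fact, no typed input introduced; census certificates enter
as HYPOTHESES per row, never as facts; the PUBLISHED inputs are hypotheses BY NAME exactly as in
FILE 7 (`X1/GeneratorCountLayerCertificates`) and gen 20's `X1/GeneratorCountLayerAtPLocal`:
Poitou–Tate duality over `ℚ_n` (`hPT`), Tate's local Euler–Poincaré characteristic at the places
of `ℚ_n` (`hEP`), Greenberg's Prop. 2.4 (`hGrK`), Wuthrich Thm. 16, Greenberg Thm. 4.1 /
Prop. 3.10 / Prop. 4.15 (ii), modularity, Gross–Zagier–Kolyvagin; nothing about any particular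
curve is asserted.

## What and why

Gen 20 (`GeneratorCountLayerAtPLocal.pow_card_add_two_le_pow_mul_sq`) supplied the local term
`a = 2` of X1R0-GAPMAP §14.1 at the prime of `ℚ_n` above `p` for curves with a RATIONAL point of
order `p`: `p^{#T₀ + 2} ≤ p^{λ(X) + pⁿμ(X)} · (#E[p^∞]^{Γ_ℚ})²` for Tamagawa witnesses `T₀` at places
`w ∤ p` of `ℚ_n`. FILE 7 did the census-column assembly (`#{w ∣ v} = p^{min(n, m_v)}` from
`v_p(N(v)^{p−1} − 1) = m_v + 1`, a witness at every `w ∣ v` from `p ∣ c_v`) for members WITHOUT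
rational `p`-torsion. THIS FILE is the same assembly ending in gen 20's count, i.e. the `δ = 1`
column of §14.1 at every layer:

* §1 `pow_sum_pow_min_add_two_le_of_certificates` /
  **`sum_pow_min_add_two_le_of_certificates`: `Σ_{v ∈ S} p^{min(n, m_v)} + 2 ≤ λ(X) + pⁿ μ(X) + 2k`**
  for `E/ℚ` globally minimal, `p` odd good ordinary, a rational point of order `p`,
  `#E[p^∞]^{Γ_ℚ} ≤ p^k`, ANY torsion dual datum over a cyclotomic `κ` without non-zero finite
  submodules, the three census columns on `S`; `…_of_rationalTorsion`: `k ≥ v_p(#E(ℚ)_tors)`.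
* §2 **`AlgebraicLambdaMem.of_layerCertificates_rationalTorsion`**:
  `λ_alg ∈ {d | Σ_{v ∈ S} p^{min(n, m_v)} + 2 ≤ d + pⁿ m' + 2k}` at a good ordinary Eisenstein pair
  with `μ_an ≤ m'` (FILE 3 `GeneratorCountMu.mu_le_of_analyticMuLE`) and Prop. 4.15 (ii) by name.
* §3 the leaf ENDS on X1 ∩ {r = 0}: `Leaf.bsdp_of_muPartAt_of_layerCertificates_rationalTorsion`
  (`MuPartAt ∧ μ_an ≤ m' ∧ λ_an = N ∧ columns ∧ gap ⇒ BSD(E,p)`) and the intersected form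
  `…_inter` with any other membership certificate `A'` (route N's divisor degrees, route D, FILE 3's
  layer-0 set).

So the 11 layer-1 classes of X1R0-GAPMAP §26.1 (4 `TAM+LB` `354730m 426923b 442187j 83842a @3`,
7 `M:paper` `32042b 92759c 131366a 222338f 262946c 282310u 390218c @3`; all with `E(ℚ)[3] ≠ 0`)
have, at `n = 1`, `p = 3`, the END-TO-END kernel shape of the layer-0 rows: `t₁ + 2 − 2k − 3m' ≤ λ`
read at their binding member, intersected with the row's other certificate, modulo the named
published inputs and the typed per-pair certificates (`AnalyticMuLE` / `MuPartAt`, `AnalyticLambdaEq`,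
the census columns). Nothing is booked by this file.

References: [GreenbergLNM1716] §2 Prop. 2.4, §3 Lemma 3.1, Lemma 3.4 (p. 89), Prop. 3.10, Thm. 4.1,
Prop. 4.15 (ii), §5 pp. 114–118, p. 137; [Washington1997] §13.1; [MilneADT2006] I Thm. 2.8,
Thm. 4.10; [Wuthrich2014] Thm. 16; X1R0-GAPMAP §14.1, §26–§30.
-/

noncomputable section

open scoped Classical

open Function Field NumberField IsDedekindDomain WeierstrassCurve PowerSeries
  Literature.NumberTheory.EllipticCurves Literature.NumberTheory.GaloisRepresentations
  Literature.NumberTheory.GaloisCohomology Summit.BirchSwinnertonDyer.Rank1Residual.GaloisImage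
  Literature.NumberTheory.EllipticCurves.IwasawaAlgebra
  Summit.BirchSwinnertonDyer.Rank1Residual.Additive
  Summit.BirchSwinnertonDyer.Rank1Residual.Additive.ZpTower
open Literature.NumberTheory.GaloisRepresentations.DiscreteGaloisModule (unramifiedSubgroup)
open Literature.NumberTheory.EllipticCurves.Greenberg1999 (imKummer_ge_strictCondition_goodOrdinary)

set_option autoImplicit false

namespace Summit.BirchSwinnertonDyer.Rank1Residual.X1.GeneratorCountLayerCertificatesTorsion

variable {W : WeierstrassCurve ℚ} [W.IsElliptic] [W.IsGloballyMinimal] {p : ℕ} [hp : Fact p.Prime]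

/-! ## §1. `Σ_{v ∈ S} p^{min(n, m_v)} + 2 ≤ λ(X) + pⁿ μ(X) + 2k` from the three census columns -/

/-- **Route M's layer-`n` count at a member with a RATIONAL point of order `p`, census form.**
`E = W/ℚ` globally minimal, `p` odd good ordinary (`p ∤ a_p`), a rational point of order `p`, `κ`
cyclotomic with any `γ`, `D` a Pontryagin-dual datum of `Sel_{p^∞}(E/ℚ_∞)` with `X = D.X` finitely
generated, torsion, without non-zero finite submodules; `S` a finite set of places `v ∤ p` with
`v_p(N(v)^{p−1} − 1) = m_v + 1` and `p ∣ c_v`. Modulo Poitou–Tate duality over `ℚ_n` (`hPT`), the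
local Euler–Poincaré formula at the places of `ℚ_n` (`hEP`) and Greenberg's Prop. 2.4 (`hGrK`),
named PUBLISHED facts: **`p^{Σ_{v ∈ S} p^{min(n, m_v)} + 2} ≤ p^{λ(X) + pⁿ μ(X)} · (#E[p^∞]^{Γ_ℚ})²`**
— n1011's census-column assembly (`#{w ∣ v} = p^{min(n,m_v)}`, a witness at every `w ∣ v`) fed to
gen 20's `GeneratorCountLayerAtPLocal.pow_card_add_two_le_pow_mul_sq` (local term `a = 2`).
[cite: GreenbergLNM1716, §2 Prop. 2.4, §3 Lemma 3.4 (p. 89), §5 pp. 114–118, p. 137]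
[cite: Washington1997, §13.1 (Prop. 13.2)] -/
theorem pow_sum_pow_min_add_two_le_of_certificates (hodd : p ≠ 2) (n : ℕ)
    (hPT : ∀ (κ : ZpExtension ℚ p) [NumberField (κ.layer n)], κ.IsCyclotomic →
      poitouTate_selmerStructure_duality (κ.layer n))
    (hEP : ∀ (κ : ZpExtension ℚ p) [NumberField (κ.layer n)], κ.IsCyclotomic →
      ∀ w : HeightOneSpectrum (𝓞 (κ.layer n)),
      localEulerPoincareCharacteristic (w.adicCompletion (κ.layer n)))
    (hGrK : imKummer_ge_strictCondition_goodOrdinary)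
    (hgood : W.HasGoodReductionAtPrime p) (hord : ¬ (p : ℤ) ∣ W.frobeniusTrace p)
    (hT : ∃ T : W.toAffine.Point, addOrderOf T = p)
    (vp : HeightOneSpectrum (𝓞 ℚ)) (hvp : ((p : ℕ) : 𝓞 ℚ) ∈ vp.asIdeal)
    (S : Finset (HeightOneSpectrum (𝓞 ℚ))) (m : HeightOneSpectrum (𝓞 ℚ) → ℕ)
    (hSp : ∀ v ∈ S, ((p : ℕ) : 𝓞 ℚ) ∉ v.asIdeal)
    (hval : ∀ v ∈ S, padicValNat p (v.residueCard ^ (p - 1) - 1) = m v + 1)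
    (hcv : ∀ v ∈ S,
      p ∣ (W.baseChange (v.adicCompletion ℚ)).localTamagawaNumber (v.adicCompletionIntegers ℚ))
    {κ : ZpExtension ℚ p} {γ : Field.absoluteGaloisGroup ℚ} (hκ : κ.IsCyclotomic)
    (D : W.SelmerDualData κ γ) [Module.Finite (IwasawaAlgebra p) D.X] (hX : D.IsTorsion)
    (hnf : ∀ N : Submodule (IwasawaAlgebra p) D.X, Finite N → N = ⊥) :
    p ^ (∑ v ∈ S, p ^ min n (m v) + 2) ≤
      p ^ (lambdaInvariant p D.X + p ^ n * muInvariant p D.X) *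
        Nat.card (MulAction.fixedPoints (Field.absoluteGaloisGroup ℚ) (geomPrimaryTorsion W p)) ^ 2 := by
  haveI : NeZero p := ⟨hp.out.ne_zero⟩
  have hΔ : ¬ (p : ℤ) ∣ minimalDiscriminantInt W :=
    W.not_dvd_minimalDiscriminantInt_of_hasGoodReductionAtPrime' p hgood
  have hres := ZpTower.exists_restrictTower κ n
  obtain ⟨κn, hκn⟩ := hres
  have hPT' := hPT κ hκ p
  obtain ⟨inv, hperf, hsum, -, hcompl⟩ := hPT'
  -- places of `ℚ_n` over `S` with their witnesses
  obtain ⟨T₀, hcard, hP⟩ := exists_finset_placesOver_card_ge S (fun v ↦ p ^ min n (m v))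
    (fun v hv ↦ (pow_min_eq_natCard_placesOver_layer κ hκ hodd n (hSp v hv) (hval v hv)).le)
    (fun w ↦ ((p : ℕ) : 𝓞 (κ.layer n)) ∉ w.asIdeal ∧
      ∃ u ∈ unramifiedSubgroup
          (((W.baseChange (κ.layer n)).torsionGaloisModule (p : ℤ)).restrictField
            (w.adicCompletion (κ.layer n))) 1,
        u ∉ (W.baseChange (κ.layer n)).kummerLocalConditionAt (p : ℤ)
          (w.adicCompletion (κ.layer n)))
    (fun v hv w hw ↦ ⟨natCast_not_mem_asIdeal_of_under_eq (hSp v hv) w hw,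
      exists_mem_unramifiedSubgroup_not_mem_kummerLocalConditionAt_layer_of_odd_of_dvd_localTamagawaNumber
        hodd κ n (hSp v hv) (hcv v hv) w hw⟩)
  have h := GeneratorCountLayerAtPLocal.pow_card_add_two_le_pow_mul_sq W κ n κn hκn D hgood hX hnf
    hodd hκ hGrK vp hvp hΔ hord hT inv hperf hsum hcompl (hEP κ hκ) T₀ (fun w hw ↦ (hP w hw).1)
    fun w hw ↦ (hP w hw).2
  exact (Nat.pow_le_pow_right hp.out.pos (Nat.add_le_add_right hcard 2)).trans h

/-- **`Σ_{v ∈ S} p^{min(n, m_v)} + 2 ≤ λ(X) + pⁿ μ(X) + 2k`** when `#E[p^∞]^{Γ_ℚ} ≤ p^k` (same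
hypotheses): X1R0-GAPMAP §14.1's `t_n + a − 2δ ≤ λ + pⁿμ` with `a = 2` and `p^δ ≤ p^k`.
[cite: GreenbergLNM1716, §2 Prop. 2.4, §3 Lemma 3.1, Lemma 3.4 (p. 89), §5 pp. 114–118, p. 137]
[cite: Washington1997, §13.1 (Prop. 13.2)] -/
theorem sum_pow_min_add_two_le_of_certificates (hodd : p ≠ 2) (n : ℕ)
    (hPT : ∀ (κ : ZpExtension ℚ p) [NumberField (κ.layer n)], κ.IsCyclotomic →
      poitouTate_selmerStructure_duality (κ.layer n))
    (hEP : ∀ (κ : ZpExtension ℚ p) [NumberField (κ.layer n)], κ.IsCyclotomic →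
      ∀ w : HeightOneSpectrum (𝓞 (κ.layer n)),
      localEulerPoincareCharacteristic (w.adicCompletion (κ.layer n)))
    (hGrK : imKummer_ge_strictCondition_goodOrdinary)
    (hgood : W.HasGoodReductionAtPrime p) (hord : ¬ (p : ℤ) ∣ W.frobeniusTrace p)
    (hT : ∃ T : W.toAffine.Point, addOrderOf T = p) {k : ℕ}
    (hk : Nat.card (MulAction.fixedPoints (Field.absoluteGaloisGroup ℚ) (geomPrimaryTorsion W p)) ≤
      p ^ k)
    (vp : HeightOneSpectrum (𝓞 ℚ)) (hvp : ((p : ℕ) : 𝓞 ℚ) ∈ vp.asIdeal)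
    (S : Finset (HeightOneSpectrum (𝓞 ℚ))) (m : HeightOneSpectrum (𝓞 ℚ) → ℕ)
    (hSp : ∀ v ∈ S, ((p : ℕ) : 𝓞 ℚ) ∉ v.asIdeal)
    (hval : ∀ v ∈ S, padicValNat p (v.residueCard ^ (p - 1) - 1) = m v + 1)
    (hcv : ∀ v ∈ S,
      p ∣ (W.baseChange (v.adicCompletion ℚ)).localTamagawaNumber (v.adicCompletionIntegers ℚ))
    {κ : ZpExtension ℚ p} {γ : Field.absoluteGaloisGroup ℚ} (hκ : κ.IsCyclotomic)
    (D : W.SelmerDualData κ γ) [Module.Finite (IwasawaAlgebra p) D.X] (hX : D.IsTorsion)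
    (hnf : ∀ N : Submodule (IwasawaAlgebra p) D.X, Finite N → N = ⊥) :
    ∑ v ∈ S, p ^ min n (m v) + 2 ≤ lambdaInvariant p D.X + p ^ n * muInvariant p D.X + 2 * k := by
  have h := pow_sum_pow_min_add_two_le_of_certificates hodd n hPT hEP hGrK hgood hord hT vp hvp S m
    hSp hval hcv hκ D hX hnf
  have h2 : p ^ (∑ v ∈ S, p ^ min n (m v) + 2) ≤
      p ^ (lambdaInvariant p D.X + p ^ n * muInvariant p D.X + 2 * k) :=
    calc p ^ (∑ v ∈ S, p ^ min n (m v) + 2)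
        ≤ p ^ (lambdaInvariant p D.X + p ^ n * muInvariant p D.X) *
          Nat.card (MulAction.fixedPoints (Field.absoluteGaloisGroup ℚ) (geomPrimaryTorsion W p)) ^ 2 := h
      _ ≤ p ^ (lambdaInvariant p D.X + p ^ n * muInvariant p D.X) * (p ^ k) ^ 2 :=
          Nat.mul_le_mul_left _ (Nat.pow_le_pow_left hk 2)
      _ = p ^ (lambdaInvariant p D.X + p ^ n * muInvariant p D.X + 2 * k) := by
          rw [← pow_mul, ← pow_add, Nat.mul_comm k 2]
  exact (Nat.pow_le_pow_iff_right hp.out.one_lt).mp h2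

/-- **The same from RATIONAL data**: `v_p(#E(ℚ)_tors) ≤ k` (so `#E[p^∞]^{Γ_ℚ} ≤ p^k` by Galois
descent, FILE 8 `GeneratorCountTorsion.natCard_fixedPoints_le_pow_factorization_torsionOrder`) and a
rational point `P ≠ 0` with `p • P = 0`. [cite: GreenbergLNM1716, §2 Prop. 2.4, §3 Lemma 3.1,
Lemma 3.4 (p. 89), §5 pp. 114–118, p. 137] [cite: Washington1997, §13.1 (Prop. 13.2)] -/
theorem sum_pow_min_add_two_le_of_rationalTorsion (hodd : p ≠ 2) (n : ℕ)
    (hPT : ∀ (κ : ZpExtension ℚ p) [NumberField (κ.layer n)], κ.IsCyclotomic →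
      poitouTate_selmerStructure_duality (κ.layer n))
    (hEP : ∀ (κ : ZpExtension ℚ p) [NumberField (κ.layer n)], κ.IsCyclotomic →
      ∀ w : HeightOneSpectrum (𝓞 (κ.layer n)),
      localEulerPoincareCharacteristic (w.adicCompletion (κ.layer n)))
    (hGrK : imKummer_ge_strictCondition_goodOrdinary)
    (hgood : W.HasGoodReductionAtPrime p) (hord : ¬ (p : ℤ) ∣ W.frobeniusTrace p)
    {k : ℕ} (hk : (W.torsionOrder).factorization p ≤ k)
    (hPt : ∃ P : W.toAffine.Point, P ≠ 0 ∧ p • P = 0)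
    (vp : HeightOneSpectrum (𝓞 ℚ)) (hvp : ((p : ℕ) : 𝓞 ℚ) ∈ vp.asIdeal)
    (S : Finset (HeightOneSpectrum (𝓞 ℚ))) (m : HeightOneSpectrum (𝓞 ℚ) → ℕ)
    (hSp : ∀ v ∈ S, ((p : ℕ) : 𝓞 ℚ) ∉ v.asIdeal)
    (hval : ∀ v ∈ S, padicValNat p (v.residueCard ^ (p - 1) - 1) = m v + 1)
    (hcv : ∀ v ∈ S,
      p ∣ (W.baseChange (v.adicCompletion ℚ)).localTamagawaNumber (v.adicCompletionIntegers ℚ))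
    {κ : ZpExtension ℚ p} {γ : Field.absoluteGaloisGroup ℚ} (hκ : κ.IsCyclotomic)
    (D : W.SelmerDualData κ γ) [Module.Finite (IwasawaAlgebra p) D.X] (hX : D.IsTorsion)
    (hnf : ∀ N : Submodule (IwasawaAlgebra p) D.X, Finite N → N = ⊥) :
    ∑ v ∈ S, p ^ min n (m v) + 2 ≤ lambdaInvariant p D.X + p ^ n * muInvariant p D.X + 2 * k := by
  obtain ⟨P, hP0, hpP⟩ := hPt
  have hT : ∃ T : W.toAffine.Point, addOrderOf T = p := ⟨P, addOrderOf_eq_prime hpP hP0⟩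
  have hB : Nat.card (MulAction.fixedPoints (Field.absoluteGaloisGroup ℚ) (geomPrimaryTorsion W p)) ≤
      p ^ k :=
    (GeneratorCountTorsion.natCard_fixedPoints_le_pow_factorization_torsionOrder W p).trans
      (Nat.pow_le_pow_right hp.out.pos hk)
  exact sum_pow_min_add_two_le_of_certificates hodd n hPT hEP hGrK hgood hord hT hB vp hvp S m hSp
    hval hcv hκ D hX hnf

/-! ## §2. On the leaf X1 ∩ {r = 0}: the layer-`n` certificate at `δ = 1` as a membership set -/

section Leaf

open Literature.NumberTheory.EllipticCurves.Rank1Residual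
  Literature.NumberTheory.EllipticCurves.ModularForms
  Literature.NumberTheory.EllipticCurves.Greenberg1999
  Summit.BirchSwinnertonDyer.BirchSwinnertonDyer.Theorems.Rank1ResidualX1Defs
  Summit.BirchSwinnertonDyer.Rank1Residual.X1.MuLambda
  Summit.BirchSwinnertonDyer.Rank1Residual.X1.MuPart
  Summit.BirchSwinnertonDyer.Rank1Residual.X1.ParitySqueeze
  Summit.BirchSwinnertonDyer.Rank1Residual.X1.TamagawaSqueeze
  Summit.BirchSwinnertonDyer.Rank1Residual.X1.FactorSqueeze
  Summit.BirchSwinnertonDyer.Rank1Residual.X1.GeneratorSqueeze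
  Summit.BirchSwinnertonDyer.Rank1Residual.X1.GeneratorCountSqueeze
  Summit.BirchSwinnertonDyer.Rank1Residual.X1.GeneratorCountSqueezeFacts

/-- **`λ_alg ∈ {d | Σ_{v ∈ S} p^{min(n, m_v)} + 2 ≤ d + pⁿ m' + 2k}` at a member with `μ_an ≤ m'`,
a rational point of order `p` and `v_p(#E(ℚ)_tors) ≤ k`** — good ordinary Eisenstein pair, `p ≠ 2`;
Wuthrich Thm. 16 + modularity (`μ(X) ≤ m'`, FILE 3 `GeneratorCountMu.mu_le_of_analyticMuLE`),
Greenberg Prop. 4.15 (ii) by name (no finite submodule, `p ≥ 3` good ordinary), Poitou–Tate /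
Euler–Poincaré over `ℚ_n`, Prop. 2.4; census columns per row.
[cite: GreenbergLNM1716, §2 Prop. 2.4, §3 Lemma 3.4, Prop. 4.15 (ii), §5 pp. 114–118, p. 137]
[cite: Washington1997, §13.1] [cite: Wuthrich2014, Thm. 16 (p. 397)] -/
theorem AlgebraicLambdaMem.of_layerCertificates_rationalTorsion
    (hW16 : Wuthrich2014.charIdeal_dvd_padicLFunction) (hmod : nonempty_modularParametrizationData)
    (h415 : prop415ii_noFiniteSubmodule_of_ordinary_or_multiplicative)
    (hp2 : p ≠ 2) (hgood : W.HasGoodReductionAtPrime p) (hord : ¬ (p : ℤ) ∣ W.frobeniusTrace p)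
    (hred : ¬ W.HasIrreducibleModPGaloisRep p) {m' : ℕ} (hμ : AnalyticMuLE W p m') (n : ℕ)
    (hPT : ∀ (κ : ZpExtension ℚ p) [NumberField (κ.layer n)], κ.IsCyclotomic →
      poitouTate_selmerStructure_duality (κ.layer n))
    (hEP : ∀ (κ : ZpExtension ℚ p) [NumberField (κ.layer n)], κ.IsCyclotomic →
      ∀ w : HeightOneSpectrum (𝓞 (κ.layer n)),
      localEulerPoincareCharacteristic (w.adicCompletion (κ.layer n)))
    (hGrK : imKummer_ge_strictCondition_goodOrdinary)
    {k : ℕ} (hk : (W.torsionOrder).factorization p ≤ k)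
    (hPt : ∃ P : W.toAffine.Point, P ≠ 0 ∧ p • P = 0)
    (vp : HeightOneSpectrum (𝓞 ℚ)) (hvp : ((p : ℕ) : 𝓞 ℚ) ∈ vp.asIdeal)
    (S : Finset (HeightOneSpectrum (𝓞 ℚ))) (m : HeightOneSpectrum (𝓞 ℚ) → ℕ)
    (hSp : ∀ v ∈ S, ((p : ℕ) : 𝓞 ℚ) ∉ v.asIdeal)
    (hval : ∀ v ∈ S, padicValNat p (v.residueCard ^ (p - 1) - 1) = m v + 1)
    (hcv : ∀ v ∈ S,
      p ∣ (W.baseChange (v.adicCompletion ℚ)).localTamagawaNumber (v.adicCompletionIntegers ℚ)) :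
    AlgebraicLambdaMem W p {d | ∑ v ∈ S, p ^ min n (m v) + 2 ≤ d + p ^ n * m' + 2 * k} := by
  intro κ γ hκ hγ hγ' D _ hXt
  have hμD : D.mu ≤ m' :=
    GeneratorCountMu.mu_le_of_analyticMuLE hW16 hmod hp2 hgood hord hred hμ hκ hγ hγ' D
  have hp3 : 3 ≤ p := lt_of_le_of_ne (Nat.Prime.two_le hp.out) (Ne.symm hp2)
  have hnf : ∀ N : Submodule (IwasawaAlgebra p) D.X, Finite N → N = ⊥ :=
    noFiniteSubmoduleAt_of_prop415ii h415 hp3 hgood hord hκ hγ hγ' D hXt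
  have h := sum_pow_min_add_two_le_of_rationalTorsion hp2 n hPT hEP hGrK hgood hord hk hPt vp hvp S m
    hSp hval hcv hκ D hXt hnf
  have hμD' : muInvariant p D.X ≤ m' := hμD
  show ∑ v ∈ S, p ^ min n (m v) + 2 ≤ lambdaInvariant p D.X + p ^ n * m' + 2 * k
  exact h.trans (Nat.add_le_add_right (Nat.add_le_add_left (Nat.mul_le_mul_left _ hμD') _) _)

/-! ## §3. The leaf ENDS -/

/-- **ROUTE M at layer `n`, `δ = 1` member, any `μ` ⇒ BSD(E,p) on the leaf**: `MuPartAt ∧ μ_an ≤ m'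
∧ λ_an = N ∧ rational point of order p ∧ v_p(#E(ℚ)_tors) ≤ k ∧ (three census columns on S at
layer n) ∧ gap ⇒ BSD(E,p)`, gap check `∀ d, Σ_{v∈S} p^{min(n,m_v)} + 2 ≤ d + pⁿm' + 2k → Even d →
d ≤ N → N ≤ d + 1`. The 4 `TAM+LB` and 7 `M:paper` layer-1 classes of X1R0-GAPMAP §26.1 bind at
`n = 1`, `p = 3`, `k = 1` (use `…_inter` below to meet the row's second certificate).
[cite: GreenbergLNM1716, §2 Prop. 2.4, §3 Lemma 3.4, Prop. 3.10, Thm. 4.1, Prop. 4.15 (ii), §5 pp. 114–118, p. 137]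
[cite: Washington1997, §13.1] [cite: Wuthrich2014, Thm. 16 (p. 397)] -/
theorem Leaf.bsdp_of_muPartAt_of_layerCertificates_rationalTorsion
    (hW16 : Wuthrich2014.charIdeal_dvd_padicLFunction) (hGr : greenberg_charValue_rankZero)
    (h310 : prop310_selmerCorank_mod_two_eq_lambdaInvariant)
    (h415 : prop415ii_noFiniteSubmodule_of_ordinary_or_multiplicative)
    (hmod : nonempty_modularParametrizationData)
    (hGZK : rank_eq_analyticRank_of_analyticRank_le_one) (hL : RankZero.Leaf W p)
    (hμP : MuPartAt W p) {m' N : ℕ} (hμ : AnalyticMuLE W p m') (hlam : AnalyticLambdaEq W p N) (n : ℕ)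
    (hPT : ∀ (κ : ZpExtension ℚ p) [NumberField (κ.layer n)], κ.IsCyclotomic →
      poitouTate_selmerStructure_duality (κ.layer n))
    (hEP : ∀ (κ : ZpExtension ℚ p) [NumberField (κ.layer n)], κ.IsCyclotomic →
      ∀ w : HeightOneSpectrum (𝓞 (κ.layer n)),
      localEulerPoincareCharacteristic (w.adicCompletion (κ.layer n)))
    (hGrK : imKummer_ge_strictCondition_goodOrdinary)
    {k : ℕ} (hk : (W.torsionOrder).factorization p ≤ k)
    (hPt : ∃ P : W.toAffine.Point, P ≠ 0 ∧ p • P = 0)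
    (vp : HeightOneSpectrum (𝓞 ℚ)) (hvp : ((p : ℕ) : 𝓞 ℚ) ∈ vp.asIdeal)
    (S : Finset (HeightOneSpectrum (𝓞 ℚ))) (m : HeightOneSpectrum (𝓞 ℚ) → ℕ)
    (hSp : ∀ v ∈ S, ((p : ℕ) : 𝓞 ℚ) ∉ v.asIdeal)
    (hval : ∀ v ∈ S, padicValNat p (v.residueCard ^ (p - 1) - 1) = m v + 1)
    (hcv : ∀ v ∈ S,
      p ∣ (W.baseChange (v.adicCompletion ℚ)).localTamagawaNumber (v.adicCompletionIntegers ℚ))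
    (hgap : ∀ d, ∑ v ∈ S, p ^ min n (m v) + 2 ≤ d + p ^ n * m' + 2 * k → Even d → d ≤ N →
      N ≤ d + 1) :
    BSDp W p :=
  have hX := isClassX1_of_classX1 hL.classX1
  GeneratorSqueeze.Leaf.bsdp_of_lambdaMem hW16 hGr h310 hmod hGZK hL hμP hlam
    (AlgebraicLambdaMem.of_layerCertificates_rationalTorsion hW16 hmod h415 hX.two_ne
      hX.hasGoodReductionAtPrime hX.not_dvd_frobeniusTrace hX.not_hasIrreducibleModPGaloisRep hμ n hPT
      hEP hGrK hk hPt vp hvp S m hSp hval hcv)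
    fun d hd ↦ hgap d hd

/-- **ROUTE M at layer `n`, `δ = 1` ∧ any other membership certificate ⇒ BSD(E,p) on the leaf**
(the intersected form: `A'` = route N's divisor-degree set, route D's bound, FILE 3's layer-0 set,
…), gap check on `A' ∩ {d | Σ + 2 ≤ d + pⁿm' + 2k}`.
[cite: GreenbergLNM1716, §2 Prop. 2.4, §3 Lemma 3.4, Prop. 3.10, Thm. 4.1, Prop. 4.15 (ii), §5 pp. 114–118, p. 137]
[cite: Washington1997, §13.1] [cite: Wuthrich2014, Thm. 16 (p. 397)] -/
theorem Leaf.bsdp_of_muPartAt_of_layerCertificates_rationalTorsion_inter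
    (hW16 : Wuthrich2014.charIdeal_dvd_padicLFunction) (hGr : greenberg_charValue_rankZero)
    (h310 : prop310_selmerCorank_mod_two_eq_lambdaInvariant)
    (h415 : prop415ii_noFiniteSubmodule_of_ordinary_or_multiplicative)
    (hmod : nonempty_modularParametrizationData)
    (hGZK : rank_eq_analyticRank_of_analyticRank_le_one) (hL : RankZero.Leaf W p)
    (hμP : MuPartAt W p) {m' N : ℕ} (hμ : AnalyticMuLE W p m') (hlam : AnalyticLambdaEq W p N) (n : ℕ)
    (hPT : ∀ (κ : ZpExtension ℚ p) [NumberField (κ.layer n)], κ.IsCyclotomic →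
      poitouTate_selmerStructure_duality (κ.layer n))
    (hEP : ∀ (κ : ZpExtension ℚ p) [NumberField (κ.layer n)], κ.IsCyclotomic →
      ∀ w : HeightOneSpectrum (𝓞 (κ.layer n)),
      localEulerPoincareCharacteristic (w.adicCompletion (κ.layer n)))
    (hGrK : imKummer_ge_strictCondition_goodOrdinary)
    {k : ℕ} (hk : (W.torsionOrder).factorization p ≤ k)
    (hPt : ∃ P : W.toAffine.Point, P ≠ 0 ∧ p • P = 0)
    (vp : HeightOneSpectrum (𝓞 ℚ)) (hvp : ((p : ℕ) : 𝓞 ℚ) ∈ vp.asIdeal)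
    (S : Finset (HeightOneSpectrum (𝓞 ℚ))) (m : HeightOneSpectrum (𝓞 ℚ) → ℕ)
    (hSp : ∀ v ∈ S, ((p : ℕ) : 𝓞 ℚ) ∉ v.asIdeal)
    (hval : ∀ v ∈ S, padicValNat p (v.residueCard ^ (p - 1) - 1) = m v + 1)
    (hcv : ∀ v ∈ S,
      p ∣ (W.baseChange (v.adicCompletion ℚ)).localTamagawaNumber (v.adicCompletionIntegers ℚ))
    {A' : Set ℕ} (hA' : AlgebraicLambdaMem W p A')
    (hgap : ∀ d ∈ A', ∑ v ∈ S, p ^ min n (m v) + 2 ≤ d + p ^ n * m' + 2 * k → Even d → d ≤ N →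
      N ≤ d + 1) :
    BSDp W p :=
  have hX := isClassX1_of_classX1 hL.classX1
  GeneratorSqueeze.Leaf.bsdp_of_lambdaMem hW16 hGr h310 hmod hGZK hL hμP hlam
    (hA'.inter (AlgebraicLambdaMem.of_layerCertificates_rationalTorsion hW16 hmod h415 hX.two_ne
      hX.hasGoodReductionAtPrime hX.not_dvd_frobeniusTrace hX.not_hasIrreducibleModPGaloisRep hμ n hPT
      hEP hGrK hk hPt vp hvp S m hSp hval hcv))
    fun d ⟨hd, hB⟩ ↦ hgap d hd hB

end Leaf

end Summit.BirchSwinnertonDyer.Rank1Residual.X1.GeneratorCountLayerCertificatesTorsion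

end
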